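import Summits.NavierStokesRegularity.NavierStokesRegularity.Theorems.PoloidalWindowDoorPoloidalWindowRigidityPressureGradientIdentity
import Literature.Analysis.FluidPDE.QuietShellPressureBudget
import HarnessLib

/-!
# The gauge-free shell budget of the CLASSICAL pressure of a bounded Oseen-mild solution with a quiet shell
# (ROUND-27 «THE √2 APEX», T27-A′ step (ii) = `target_shell_pressure_L1` in classical form; item
# `TerminalTrace.TypeITraceScarL3`, stmt-NavierStokesRegularity-18385, Stub LOUD line; helper)

Seat nsreg-typer g21 (cell ns-regularity-ideate; PLATE — Theorems/ is prover-only, fired by a prover seat with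
`--supports stmt-NavierStokesRegularity-18385 --as helper`); planner-of-record nsreg-p2 g29 (T27A-PLAN §2),
consumer nsreg-C26-p1 g2 (`two_le_rateSq_of_shellData`, `…SqrtTwoApexTimeLayer`: the «GAUGE-FREE shell budget
∫_K |q(t) − c| ≤ m_P» of the classical pressure `q`).

ONE TIME `τ`: a classical solution `(u, p)` of the unit-viscosity unforced Navier–Stokes system on an open time set
`S ⊇ [τ−η, τ+η]`, bounded by `M` there and Oseen-mild between any two of these times (VERBATIM the hypotheses of
nsreg-p7's `sliceFunctional_eq_zero_of_mild` = VERBATIM the Oseen clause of the tree's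
`exists_classical_repr_of_apexPackage`), with the slice `u τ` QUIET (`‖u τ y‖ ≤ K` for `R₁ < |y| < R₂`) and of
uniformly local energy `α` at scale `r` (`R₂ ≤ 2r`).  Then (`exists_shellBudget_of_mild`) there is a constant
`κ` with, for every sub-shell `{ρ₁ < |y| < ρ₂}`, `R₁ + θ ≤ ρ₁`, `ρ₂ ≤ R₂ − θ`, `ρ₂ ≤ r`, `θ > 0`:

  `∫_{ρ₁<|y|<ρ₂} |p(τ,y) − κ| ≤ C(r) K² |S| + ((2πθ³)⁻¹ ∫_{B_{2r}} |u(τ)|² + F(r) α) |S|`,  `S = {R₁ < |y| < R₂}`,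

with `C(r), F(r) < ∞` depending on `r` ONLY — hence a sup-in-time budget as soon as `K`, `α`, `∫_{B_{2r}}|u(τ)|²`
are uniform in `τ` (for the apex package: `K` from `QuietShell`, `α = 2rM` and `∫_{B_{2r}} ≤ 2rM` from the Morrey
part of `𝐈 ≤ M`).  Proof BY NAME: `sliceFunctional_eq_zero_of_mild` (the slice identities `hid`, NO decay, NO
Liouville) ⇒ `QuietShellPressure.exists_subshell_pressure_budget` (tree `slice_pressure_representation` + the
shell law + the far field at scale `r`).  `integral_closedAnnulus_le_of_lintegral_annulus_le` converts to the
consumer's real-valued closed-annulus form `∫_{ρ₁≤|y|≤ρ₂} |p τ − κ| ≤ m_P` (spheres are null).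

WHAT THIS IS NOT: not T27-A′/T27-A, not the literal l.213 for the PACKAGE pressure `P` (that is this theorem for
the classical representative + the bridge `P − q = c(t)`), not NS regularity.  [folklore; Kang–Miura–Tsai 2021
Lemma 3.4; Bronzi–Shvydkoy 2015 Lemma 2.1 Step 2; Fernández-Dalgo–Lemarié-Rieusset 2021 Thm 1]
-/

noncomputable section

-- the summit and its single sub-problem share the name (CONVENTIONS §1), as in every Theorems file
set_option linter.dupNamespace false
-- nested operator types `ℝ³ →L[ℝ] ℝ³ →L[ℝ] ℝ³ →L[ℝ] ℝ`
set_option maxSynthPendingDepth 3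

namespace Summit.NavierStokesRegularity.NavierStokesRegularity.Theorems.TypeITraceScarL3

open MeasureTheory Set Function Filter Topology Metric InnerProductSpace
open scoped RealInnerProductSpace ENNReal NNReal Laplacian ContDiff
open Literature.Analysis Literature.Analysis.FluidPDE Literature.Analysis.UnboundedOperators
open Literature.Analysis.FluidPDE.QuietShellPressure
open Summit.NavierStokesRegularity.NavierStokesRegularity.Theorems.PoloidalWindowDoorPoloidalWindowRigidityPressureGradientIdentity

/-- A bounded field has `∫_{B(0,ρ)} |w|³ < ∞`. [folklore] -/
theorem lintegral_ball_cube_ne_top_of_bound {w : EuclideanSpace ℝ (Fin 3) → EuclideanSpace ℝ (Fin 3)} {M : ℝ}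
    (hM : ∀ y, ‖w y‖ ≤ M) (ρ : ℝ) :
    ∫⁻ y in ball (0 : EuclideanSpace ℝ (Fin 3)) ρ, ‖w y‖ₑ ^ (3 : ℕ) ≠ ⊤ := by
  have hfin : ENNReal.ofReal (M ^ 3) * volume (ball (0 : EuclideanSpace ℝ (Fin 3)) ρ) ≠ ⊤ :=
    ENNReal.mul_ne_top ENNReal.ofReal_ne_top measure_ball_lt_top.ne
  refine ne_top_of_le_ne_top hfin ?_
  calc ∫⁻ y in ball (0 : EuclideanSpace ℝ (Fin 3)) ρ, ‖w y‖ₑ ^ (3 : ℕ)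
      ≤ ∫⁻ y in ball (0 : EuclideanSpace ℝ (Fin 3)) ρ, ENNReal.ofReal (M ^ 3) := by
        refine lintegral_mono fun y => ?_
        rw [← ofReal_norm, ← ENNReal.ofReal_pow (norm_nonneg _)]
        exact ENNReal.ofReal_le_ofReal (pow_le_pow_left₀ (norm_nonneg _) (hM y) 3)
    _ = ENNReal.ofReal (M ^ 3) * volume (ball (0 : EuclideanSpace ℝ (Fin 3)) ρ) := by
        rw [setLIntegral_const]

variable {S : Set ℝ} {u : ℝ → EuclideanSpace ℝ (Fin 3) → EuclideanSpace ℝ (Fin 3)}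
  {p : ℝ → EuclideanSpace ℝ (Fin 3) → ℝ} {τ η M : ℝ}

/-- **THE GAUGE-FREE SHELL BUDGET OF THE CLASSICAL PRESSURE (T27-A′ (ii), classical form).** For every
`r > 0` there are `C, F < ∞` such that: for a classical solution `(u, p)` on an open `S ⊇ [τ−η, τ+η]`, bounded by
`M` there and Oseen-mild between any two of these times, with `∫_{B(z,r)} |u(τ)|² ≤ α` for all `z` and
`‖u(τ,y)‖ ≤ K` for `R₁ < |y| < R₂` (`R₂ ≤ 2r`), there is `κ` with, for all `θ > 0`, `R₁ + θ ≤ ρ₁`, `ρ₂ ≤ R₂ − θ`,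
`ρ₂ ≤ r`: `∫_{ρ₁<|y|<ρ₂} ‖p τ y − κ‖ ≤ C K² |S| + ((2πθ³)⁻¹ ∫_{B(0,2r)} |u τ|² + F α) |S|`. [folklore] -/
theorem exists_shellBudget_of_mild {r : ℝ} (hr : 0 < r) :
    ∃ C F : ℝ≥0∞, C ≠ ⊤ ∧ F ≠ ⊤ ∧
      ∀ {S : Set ℝ} {u : ℝ → EuclideanSpace ℝ (Fin 3) → EuclideanSpace ℝ (Fin 3)}
        {p : ℝ → EuclideanSpace ℝ (Fin 3) → ℝ} {τ η M : ℝ} {α : ℝ≥0∞} {R₁ R₂ K : ℝ},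
        IsOpen S → IsClassicalNSSolutionOn S 1 0 u p → 0 < η → Icc (τ - η) (τ + η) ⊆ S → 0 ≤ M →
        (∀ σ ∈ Icc (τ - η) (τ + η), ∀ y, ‖u σ y‖ ≤ M) →
        (∀ s t : ℝ, s ∈ Icc (τ - η) (τ + η) → t ∈ Icc (τ - η) (τ + η) → s < t → ∀ x,
          u t x = heatExtension (u s) (t - s) x - oseenDuhamel 1 s u u t x) →
        (∀ z : EuclideanSpace ℝ (Fin 3), ∫⁻ y in ball z r, ‖u τ y‖ₑ ^ 2 ≤ α) →
        R₂ ≤ 2 * r →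
        (∀ y : EuclideanSpace ℝ (Fin 3), R₁ < ‖y‖ → ‖y‖ < R₂ → ‖u τ y‖ ≤ K) →
        ∃ κ : ℝ, ∀ (θ ρ₁ ρ₂ : ℝ), 0 < θ → R₁ + θ ≤ ρ₁ → ρ₂ ≤ R₂ - θ → ρ₂ ≤ r →
          ∫⁻ y in {y : EuclideanSpace ℝ (Fin 3) | ρ₁ < ‖y‖ ∧ ‖y‖ < ρ₂}, ‖p τ y - κ‖ₑ ≤
            C * ENNReal.ofReal K ^ 2 * volume {z : EuclideanSpace ℝ (Fin 3) | R₁ < ‖z‖ ∧ ‖z‖ < R₂} +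
              (ENNReal.ofReal ((2 * Real.pi * θ ^ 3)⁻¹) *
                  (∫⁻ z in ball (0 : EuclideanSpace ℝ (Fin 3)) (2 * r), ‖u τ z‖ₑ ^ 2) + F * α) *
                volume {z : EuclideanSpace ℝ (Fin 3) | R₁ < ‖z‖ ∧ ‖z‖ < R₂} := by
  obtain ⟨C, F, hCtop, hFtop, hbudget⟩ := exists_subshell_pressure_budget hr
  refine ⟨C, F, hCtop, hFtop, ?_⟩
  intro S u p τ η M α R₁ R₂ K hS hcl hη hI hM0 hM hmild hα hR₂ hK
  have hτI : τ ∈ Icc (τ - η) (τ + η) := ⟨by linarith, by linarith⟩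
  have hτ : τ ∈ S := hI hτI
  have hMτ : ∀ y, ‖u τ y‖ ≤ M := hM τ hτI
  -- the slice data
  have hu : ContDiff ℝ ∞ (u τ) := hcl.contDiff_velocity hτ
  have hp : ContDiff ℝ ∞ (p τ) := hcl.contDiff_pressure hτ
  have hum : AEStronglyMeasurable (u τ) volume := hu.continuous.aestronglyMeasurable
  set A : ℝ≥0∞ := ENNReal.ofReal (M ^ 2) * volume (ball (0 : EuclideanSpace ℝ (Fin 3)) 1) with hA
  have hAtop : A ≠ ⊤ := ENNReal.mul_ne_top ENNReal.ofReal_ne_top measure_ball_lt_top.ne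
  have hAb : ∀ z : EuclideanSpace ℝ (Fin 3), ∫⁻ y in ball z 1, ‖u τ y‖ₑ ^ 2 ≤ A :=
    lintegral_ball_le_of_bound hMτ
  have hpl : LocallyIntegrable (p τ) volume := hp.continuous.locallyIntegrable
  have hI3 := lintegral_ball_cube_ne_top_of_bound hMτ (2 * r)
  -- the slice identities (nsreg-p7: Oseen-mild ⇒ `∇p = ∇ΣRᵢRⱼ(uᵢuⱼ)`, no decay needed)
  have hid : ∀ (n : ℕ) (c e : EuclideanSpace ℝ (Fin 3)),
      ∫ x, (p τ x * fderiv ℝ (Δ (newtonReg ((n : ℝ) + 1)⁻¹)) (c - x) e +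
        evalDiag (u τ x) (fderiv ℝ (fderiv ℝ (fderiv ℝ (newtonReg ((n : ℝ) + 1)⁻¹))) (c - x) e)) = 0 :=
    fun n c e => sliceFunctional_eq_zero_of_mild hS hcl hη hI hM0 hM hmild (by positivity) c e
  have hK' : ∀ᵐ z ∂(volume : Measure (EuclideanSpace ℝ (Fin 3))), R₁ < ‖z‖ → ‖z‖ < R₂ → ‖u τ z‖ ≤ K :=
    Eventually.of_forall hK
  exact hbudget (u τ) (p τ) A α R₁ R₂ K hum hAtop hAb hα hI3 hpl hid hR₂ hK'

/-- **Closed-annulus, real-valued form** (the consumer's `∫_K |q − c| ≤ m_P`): if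
`∫⁻_{ρ₁<|y|<ρ₂} ‖f‖ₑ ≤ B` with `B < ∞` for a measurable `f`, then `∫_{ρ₁≤|y|≤ρ₂} |f| ≤ B.toReal`
(the two spheres are Lebesgue-null). [folklore] -/
theorem integral_closedAnnulus_le_of_lintegral_annulus_le {f : EuclideanSpace ℝ (Fin 3) → ℝ}
    (hf : AEStronglyMeasurable f volume) {ρ₁ ρ₂ : ℝ} {B : ℝ≥0∞} (hB : B ≠ ⊤)
    (h : ∫⁻ y in {y : EuclideanSpace ℝ (Fin 3) | ρ₁ < ‖y‖ ∧ ‖y‖ < ρ₂}, ‖f y‖ₑ ≤ B) :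
    ∫ y in {y : EuclideanSpace ℝ (Fin 3) | ρ₁ ≤ ‖y‖ ∧ ‖y‖ ≤ ρ₂}, |f y| ≤ B.toReal := by
  set Tc : Set (EuclideanSpace ℝ (Fin 3)) := {y | ρ₁ ≤ ‖y‖ ∧ ‖y‖ ≤ ρ₂} with hTc
  set To : Set (EuclideanSpace ℝ (Fin 3)) := {y | ρ₁ < ‖y‖ ∧ ‖y‖ < ρ₂} with hTo
  -- `Tc ⊆ To ∪ (sphere 0 ρ₁ ∪ sphere 0 ρ₂)`, the spheres are null
  have hnull : volume (Tc \ To) = 0 := by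
    refine measure_mono_null (fun y hy => ?_)
      (measure_union_null (Measure.addHaar_sphere volume (0 : EuclideanSpace ℝ (Fin 3)) ρ₁)
        (Measure.addHaar_sphere volume (0 : EuclideanSpace ℝ (Fin 3)) ρ₂))
    obtain ⟨⟨h1, h2⟩, h3⟩ := hy
    rw [hTo, mem_setOf_eq, not_and_or, not_lt, not_lt] at h3
    rcases h3 with h3 | h3
    · left
      rw [mem_sphere_zero_iff_norm]
      exact le_antisymm h3 h1
    · right
      rw [mem_sphere_zero_iff_norm]
      exact le_antisymm h2 h3
  have hle : volume.restrict Tc ≤ volume.restrict To := Measure.restrict_mono_ae (ae_le_set.2 hnull)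
  have h1 : ∫⁻ y in Tc, ‖f y‖ₑ ≤ B := (lintegral_mono' hle le_rfl).trans h
  have h2 : ∫ y in Tc, |f y| = (∫⁻ y in Tc, ‖f y‖ₑ).toReal := by
    rw [integral_eq_lintegral_of_nonneg_ae (Eventually.of_forall fun y => abs_nonneg _)
      hf.norm.restrict]
    congr 1
    refine lintegral_congr fun y => ?_
    rw [Real.enorm_eq_ofReal_abs]
  rw [h2]
  exact ENNReal.toReal_mono hB h1

end Summit.NavierStokesRegularity.NavierStokesRegularity.Theorems.TypeITraceScarL3

end
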